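import Literature.Combinatorics.Sahi2008.UnderlyingIndependents
import Literature.Probability.Percolation.TwoClusterConditionalSahi
import HarnessLib

/-!
# From product measures to the UNIFORM cube: dyadic threshold coins and the limit
# (Sahi's `C_n` for the fair-coin cubes `{0,1}^M` gives `C_n` for every FKG poset)

CITATION HEADER.  Sources: J. Kahn, *A note on positive association*, arXiv:2210.08653 (2022)
[Kahn2022], p. 2 ("One way to prove PA for `μ` is to realize the `X_i`'s as increasing functions of
independent Bernoullis `Y_1,…,Y_m` and invoke Harris; more generally, `μ` is PA if it is a limit of
measures obtained in this way") and footnote 1 (b) ("it's easy to realize the indicators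
`1_{A(i,j)}` [`A(i,j) = {Z_i > α_{i,j}}`] as nondecreasing functions of independent … Bernoullis");
E. H. Lieb, S. Sahi, arXiv:2107.09838 [LiebSahi2021], §2 before Lemma 2.2 (the UNIFORM setting:
"the unit hypercube `Q_k = [0,1]^k` … equipped with the Lebesgue measure and the usual partial order")
and Lemma 2.3 with its proof (the discretisation-and-limit step: "if `E_3(χ_{S^m},χ_{T^m},χ_{U^m}) ≥ 0`
then we get `E_3(χ_S,χ_T,χ_U) = lim_{m→∞} E_3(χ_{S^m},χ_{T^m},χ_{U^m}) ≥ 0`"); read 2026-08-19 from the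
materialised texts.  Vocabulary: `Functional.lean` (`sahiE`, `SahiPositive`, `IsFKGMeasure`),
`PushForward.lean` (`pushWeight`, `coinWeight`, `SahiPositive.of_pushWeight`),
`UnderlyingIndependents.lean` (`SahiPositive.of_isFKGMeasure_of_forall_coinWeight`), and
`Literature.Probability.Percolation.BHK2006.continuous_sahiE` (`E_n^ν(f)` is continuous in `ν`).

## What is proved (no named fact; nothing asserts Sahi's or Kahn's conjecture)

* `uniformWeight ι` — the fair-coin (uniform) weight `2^{-|ι|}` on the cube `ι → Bool`; it is an FKG
  probability weight (`isFKGMeasure_coinWeight`, log-modularity of every product weight).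
* DYADIC THRESHOLDS (footnote 1 (b) with fair coins): the binary value `binVal w = Σ_j w_j 2^j` of
  `w : Fin r → Bool` is monotone and a bijection onto `[0, 2^r)` (`binEquiv`); the threshold coin
  `thrBit r k w = 1{binVal w ≥ 2^r − k}` is monotone with exactly `k` heads configurations
  (`card_thrBit`); hence the product weight with dyadic biases `k_i/2^r` is the push-forward of the
  uniform weight on `Fin m × Fin r → Bool` along the monotone map `dyadicMap`
  (`pushWeight_uniform_dyadicMap`).
* THE LIMIT (Lieb–Sahi's Lemma 2.3 step): `q ↦ E_n^{coinWeight q}(f)` is continuous, dyadic biases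
  `⌊q_i 2^r⌋/2^r → q_i`, so uniform-cube positivity of order `n` gives positivity for EVERY product
  weight (`SahiPositive.coinWeight_of_forall_uniform`), hence — by `UnderlyingIndependents.lean` (FKG
  measures are FUI) — for every FKG probability weight on every finite distributive lattice
  (`SahiPositive.of_isFKGMeasure_of_forall_uniform`).  Summits-side (typer, cell prim-sahi):
  `SahiConjecture n ↔ ∀ ι, SahiPositive (uniformWeight ι) n` and the pure counting form of
  `KahnConjecture` (`…/Theorems/SahiConjectureUniform.lean`).
-/

noncomputable section

namespace Literature.Combinatorics.Sahi2008

open Finset Filter Topology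

/-! ### The uniform weight; product weights are FKG -/

section Uniform

variable {ι : Type*} [Fintype ι]

/-- The **uniform (fair-coin) weight** on the cube `ι → Bool`: every coin has bias `1/2`
(Lieb–Sahi's Lebesgue/uniform setting, discretised). [cite: LiebSahi2021, §2 (before Lemma 2.2); Kahn2022, p. 2] -/
abbrev uniformWeight (ι : Type*) [Fintype ι] : (ι → Bool) → ℝ := coinWeight fun _ : ι => (1 / 2 : ℝ)

/-- The uniform weight is the constant `2^{-|ι|}`. [cite: LiebSahi2021, §2 (before Lemma 2.2)] -/
theorem uniformWeight_apply (y : ι → Bool) : uniformWeight ι y = 1 / (2 : ℝ) ^ Fintype.card ι := by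
  unfold uniformWeight coinWeight
  rw [prod_congr rfl fun i _ => show (if y i = true then (1 / 2 : ℝ) else 1 - 1 / 2) = 1 / 2 by
    split_ifs <;> norm_num, prod_const, card_univ, one_div_pow]

/-- On `Bool`, `{x ⊓ x', x ⊔ x'} = {x, x'}` (plumbing). [folklore] -/
private theorem bool_inf_sup (x x' : Bool) :
    (x ⊓ x' = x ∧ x ⊔ x' = x') ∨ (x ⊓ x' = x' ∧ x ⊔ x' = x) := by
  cases x <;> cases x' <;> decide

/-- Product weights are log-MODULAR: `w(y ⊓ y')·w(y ⊔ y') = w(y)·w(y')` (coordinate by coordinate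
`{y_i ⊓ y'_i, y_i ⊔ y'_i} = {y_i, y'_i}`). [cite: Sahi2008, eqs. (2), (8) (pp. 210, 212)] -/
theorem coinWeight_inf_mul_sup (q : ι → ℝ) (y y' : ι → Bool) :
    coinWeight q (y ⊓ y') * coinWeight q (y ⊔ y') = coinWeight q y * coinWeight q y' := by
  unfold coinWeight
  rw [← prod_mul_distrib, ← prod_mul_distrib]
  refine prod_congr rfl fun i _ => ?_
  rcases bool_inf_sup (y i) (y' i) with ⟨h1, h2⟩ | ⟨h1, h2⟩
  · have e1 : (y ⊓ y') i = y i := h1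
    have e2 : (y ⊔ y') i = y' i := h2
    simp only [e1, e2]
  · have e1 : (y ⊓ y') i = y' i := h1
    have e2 : (y ⊔ y') i = y i := h2
    simp only [e1, e2, mul_comm]

/-- **Every product weight with biases in `[0,1]` is an FKG probability weight** on the cube
`ι → Bool` (Sahi: product measures "satisfy (8) with equality"). [cite: Sahi2008, eqs. (2), (8) (pp. 210, 212)] -/
theorem isFKGMeasure_coinWeight [DecidableEq ι] {q : ι → ℝ} (hq : ∀ i, 0 ≤ q i ∧ q i ≤ 1) :
    IsFKGMeasure (coinWeight q) where
  nonneg := coinWeight_nonneg hq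
  sum_eq_one := sum_coinWeight q
  mul_le_mul y y' := (coinWeight_inf_mul_sup q y y').symm.le

/-- In particular the uniform weight is an FKG probability weight. [cite: LiebSahi2021, §1 (FKG posets) and §2] -/
theorem isFKGMeasure_uniformWeight [DecidableEq ι] : IsFKGMeasure (uniformWeight ι) :=
  isFKGMeasure_coinWeight fun _ => by norm_num

/-- The uniform weight is invariant under relabelling the coordinates: along the bijection of cubes
induced by `e : Fin M ≃ ι` it pushes forward to the uniform weight. [cite: LiebSahi2021, §2 (before Lemma 2.2)] -/
theorem pushWeight_uniformWeight_arrowCongr [DecidableEq ι] {M : ℕ} (e : Fin M ≃ ι) :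
    pushWeight (uniformWeight (Fin M)) (e.arrowCongr (Equiv.refl Bool)) = uniformWeight ι := by
  funext y
  rw [pushWeight_equiv, uniformWeight_apply, uniformWeight_apply, ← Fintype.card_congr e]

omit [Fintype ι] in
/-- Relabelling coordinates is monotone. [cite: LiebSahi2021, §2 (before Lemma 2.2)] -/
theorem arrowCongr_mono {M : ℕ} (e : Fin M ≃ ι) :
    Monotone (e.arrowCongr (Equiv.refl Bool) : (Fin M → Bool) → (ι → Bool)) := by
  intro y y' h i
  show (Equiv.refl Bool) (y (e.symm i)) ≤ (Equiv.refl Bool) (y' (e.symm i))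
  exact h (e.symm i)

end Uniform

/-! ### Dyadic thresholds: a coin of bias `k/2^r` is a monotone function of `r` fair coins -/

section Dyadic

variable {r : ℕ}

/-- The binary value `Σ_j [w_j] 2^j` of a bit string. [cite: Kahn2022, p. 2 footnote 1 (b)] -/
def binVal (w : Fin r → Bool) : ℕ := ∑ j, if w j then 2 ^ (j : ℕ) else 0

/-- The binary value is monotone for the product order on bit strings.
[cite: Kahn2022, p. 2 footnote 1 (b)] -/
theorem binVal_mono {w w' : Fin r → Bool} (h : w ≤ w') : binVal w ≤ binVal w' := by
  unfold binVal
  refine sum_le_sum fun j _ => ?_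
  by_cases hj : w j = true
  · rw [if_pos hj, if_pos (Bool.le_iff_imp.1 (h j) hj)]
  · rw [if_neg hj]
    exact Nat.zero_le _

/-- The binary value as the bijection `(Fin r → Bool) ≃ Fin (2^r)` (Mathlib's `finFunctionFinEquiv`
after `Bool ≃ Fin 2`). [cite: Kahn2022, p. 2 footnote 1 (b)] -/
def binEquiv (r : ℕ) : (Fin r → Bool) ≃ Fin (2 ^ r) :=
  ((Equiv.refl (Fin r)).arrowCongr finTwoEquiv.symm).trans finFunctionFinEquiv

/-- `binEquiv` computes `binVal`. [cite: Kahn2022, p. 2 footnote 1 (b)] -/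
theorem binEquiv_val (w : Fin r → Bool) : ((binEquiv r w : Fin (2 ^ r)) : ℕ) = binVal w := by
  unfold binEquiv binVal
  rw [Equiv.trans_apply, finFunctionFinEquiv_apply]
  refine sum_congr rfl fun j _ => ?_
  show ((finTwoEquiv.symm (w ((Equiv.refl (Fin r)).symm j)) : Fin 2) : ℕ) * 2 ^ (j : ℕ) = _
  rw [Equiv.refl_symm, Equiv.refl_apply]
  cases w j
  · show ((0 : Fin 2) : ℕ) * 2 ^ (j : ℕ) = if false = true then 2 ^ (j : ℕ) else 0
    simp
  · show ((1 : Fin 2) : ℕ) * 2 ^ (j : ℕ) = if true = true then 2 ^ (j : ℕ) else 0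
    simp

/-- Counting the upper tail of the binary value: `#{w | c ≤ binVal w} = 2^r − c` for `c ≤ 2^r`.
[cite: Kahn2022, p. 2 footnote 1 (b)] -/
theorem card_filter_le_binVal {c : ℕ} (hc : c ≤ 2 ^ r) :
    (univ.filter fun w : Fin r → Bool => c ≤ binVal w).card = 2 ^ r - c := by
  have h1 : (univ.filter fun w : Fin r → Bool => c ≤ binVal w).card =
      (univ.filter fun u : Fin (2 ^ r) => c ≤ (u : ℕ)).card := by
    refine card_equiv (binEquiv r) fun w => ?_
    simp only [mem_filter, mem_univ, true_and, binEquiv_val]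
  rw [h1]
  rcases hc.eq_or_lt with rfl | hlt
  · rw [Nat.sub_self, card_eq_zero, filter_eq_empty_iff]
    intro u _ hu
    exact absurd (lt_of_lt_of_le u.2 hu) (lt_irrefl _)
  · have h2 : (univ.filter fun u : Fin (2 ^ r) => c ≤ (u : ℕ)) = Finset.Ici (⟨c, hlt⟩ : Fin (2 ^ r)) := by
      ext u
      simp only [mem_filter, mem_univ, true_and, mem_Ici, Fin.le_iff_val_le_val]
    rw [h2, Fin.card_Ici]

/-- **The dyadic threshold coin**: heads iff `binVal w ≥ 2^r − k` (Kahn's `{Z_i > α}` with a dyadic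
uniform `Z`). [cite: Kahn2022, p. 2 footnote 1 (b)] -/
def thrBit (r k : ℕ) (w : Fin r → Bool) : Bool := decide (2 ^ r - k ≤ binVal w)

/-- The threshold coin is monotone in the fair coins. [cite: Kahn2022, p. 2 footnote 1 (b)] -/
theorem thrBit_mono (r k : ℕ) : Monotone (thrBit r k) := by
  intro w w' h
  refine Bool.le_iff_imp.2 fun hw => ?_
  rw [thrBit, decide_eq_true_eq] at hw ⊢
  exact le_trans hw (binVal_mono h)

/-- Exactly `k` of the `2^r` bit strings give heads (`k ≤ 2^r`). [cite: Kahn2022, p. 2 footnote 1 (b)] -/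
theorem card_thrBit_true {k : ℕ} (hk : k ≤ 2 ^ r) :
    (univ.filter fun w : Fin r → Bool => thrBit r k w = true).card = k := by
  have h : (univ.filter fun w : Fin r → Bool => thrBit r k w = true) =
      univ.filter fun w : Fin r → Bool => 2 ^ r - k ≤ binVal w := by
    ext w
    simp only [mem_filter, mem_univ, true_and, thrBit, decide_eq_true_eq]
  rw [h, card_filter_le_binVal (Nat.sub_le _ _), Nat.sub_sub_self hk]

/-- … and `2^r − k` give tails. [cite: Kahn2022, p. 2 footnote 1 (b)] -/
theorem card_thrBit_false {k : ℕ} (hk : k ≤ 2 ^ r) :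
    (univ.filter fun w : Fin r → Bool => thrBit r k w = false).card = 2 ^ r - k := by
  have htot := card_filter_add_card_filter_not (s := (univ : Finset (Fin r → Bool)))
    (fun w => thrBit r k w = true)
  rw [card_univ, Fintype.card_fun, Fintype.card_bool, Fintype.card_fin, card_thrBit_true hk] at htot
  have h : (univ.filter fun w : Fin r → Bool => ¬ thrBit r k w = true) =
      univ.filter fun w : Fin r → Bool => thrBit r k w = false := by
    ext w
    simp only [mem_filter, mem_univ, true_and, Bool.not_eq_true]
  rw [h] at htot
  omega

/-- The number of bit strings with a prescribed threshold outcome `b`.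
[cite: Kahn2022, p. 2 footnote 1 (b)] -/
theorem card_thrBit_eq {k : ℕ} (hk : k ≤ 2 ^ r) (b : Bool) :
    Fintype.card {w : Fin r → Bool // thrBit r k w = b} = if b then k else 2 ^ r - k := by
  rw [Fintype.card_subtype]
  cases b
  · exact card_thrBit_false hk
  · exact card_thrBit_true hk

/-- **The dyadic threshold map** on `m` blocks of `r` fair coins: coordinate `i` is the threshold coin
of bias `k_i/2^r` read off block `i`. [cite: Kahn2022, p. 2 footnote 1 (b)] -/
def dyadicMap (m r : ℕ) (k : Fin m → ℕ) (z : Fin m × Fin r → Bool) : Fin m → Bool :=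
  fun i => thrBit r (k i) fun j => z (i, j)

/-- The dyadic threshold map is monotone. [cite: Kahn2022, p. 2 footnote 1 (b)] -/
theorem dyadicMap_mono (m r : ℕ) (k : Fin m → ℕ) : Monotone (dyadicMap m r k) :=
  fun _ _ h i => thrBit_mono r (k i) fun j => h (i, j)

/-- Counting the fibres of the dyadic map: `#{z | dyadicMap z = y} = Π_i (k_i if y_i else 2^r − k_i)`.
[cite: Kahn2022, p. 2 footnote 1 (b)] -/
theorem card_dyadicMap_fibre {m r : ℕ} {k : Fin m → ℕ} (hk : ∀ i, k i ≤ 2 ^ r) (y : Fin m → Bool) :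
    Fintype.card {z : Fin m × Fin r → Bool // dyadicMap m r k z = y} =
      ∏ i, (if y i then k i else 2 ^ r - k i) := by
  classical
  have e1 : {z : Fin m × Fin r → Bool // dyadicMap m r k z = y} ≃
      {z' : Fin m → Fin r → Bool // ∀ i, thrBit r (k i) (z' i) = y i} :=
    (Equiv.curry (Fin m) (Fin r) Bool).subtypeEquiv fun z => by
      rw [funext_iff]
      exact Iff.rfl
  have e2 : {z' : Fin m → Fin r → Bool // ∀ i, thrBit r (k i) (z' i) = y i} ≃
      ∀ i : Fin m, {w : Fin r → Bool // thrBit r (k i) w = y i} :=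
    Equiv.subtypePiEquivPi (α := Fin m) (β := fun _ => Fin r → Bool)
      (p := fun i w => thrBit r (k i) w = y i)
  rw [Fintype.card_congr (e1.trans e2), Fintype.card_pi]
  exact prod_congr rfl fun i _ => card_thrBit_eq (hk i) (y i)

/-- **Dyadic product weights are monotone images of the uniform cube**: the product weight with biases
`k_i/2^r` (`k_i ≤ 2^r`) is the push-forward of the uniform weight on `Fin m × Fin r → Bool` along
`dyadicMap`. [cite: Kahn2022, p. 2 and footnote 1 (b); LiebSahi2021, Lemma 2.3 (discretisation)] -/
theorem pushWeight_uniform_dyadicMap {m r : ℕ} {k : Fin m → ℕ} (hk : ∀ i, k i ≤ 2 ^ r) :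
    pushWeight (uniformWeight (Fin m × Fin r)) (dyadicMap m r k) =
      coinWeight fun i => (k i : ℝ) / 2 ^ r := by
  classical
  funext y
  rw [pushWeight_apply]
  simp only [uniformWeight_apply, Fintype.card_prod, Fintype.card_fin]
  rw [show (∑ z : Fin m × Fin r → Bool, if dyadicMap m r k z = y then (1 : ℝ) / 2 ^ (m * r) else 0) =
      (1 : ℝ) / 2 ^ (m * r) * ∑ z : Fin m × Fin r → Bool, if dyadicMap m r k z = y then (1 : ℝ) else 0 by
    rw [mul_sum]
    exact sum_congr rfl fun z _ => by split_ifs <;> simp]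
  rw [sum_boole, ← Fintype.card_subtype, card_dyadicMap_fibre hk y]
  push_cast
  rw [show (1 : ℝ) / 2 ^ (m * r) = ∏ _i : Fin m, (1 : ℝ) / 2 ^ r by
    rw [prod_const, card_univ, Fintype.card_fin, one_div_pow, ← pow_mul'], ← prod_mul_distrib]
  unfold coinWeight
  refine prod_congr rfl fun i _ => ?_
  have h2 : (2 : ℝ) ^ r ≠ 0 := pow_ne_zero _ two_ne_zero
  cases y i
  · simp only [Bool.false_eq_true, ↓reduceIte]
    rw [Nat.cast_sub (hk i)]
    push_cast
    field_simp
  · simp only [↓reduceIte]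
    field_simp

end Dyadic

/-! ### The limit: uniform-cube positivity gives positivity for every product weight -/

section Limit

variable {n : ℕ}

/-- `q ↦ coinWeight q` is continuous (a finite product of affine functions of `q`, in each of the
finitely many coordinates of the cube). [cite: LiebSahi2021, Lemma 2.3 (proof: the limit step)] -/
theorem continuous_coinWeight {ι : Type*} [Fintype ι] [DecidableEq ι] :
    Continuous fun q : ι → ℝ => coinWeight q := by
  refine continuous_pi fun y => ?_
  refine continuous_finsetProd _ fun i _ => ?_
  by_cases h : y i = true
  · have e : (fun q : ι → ℝ => if y i = true then q i else 1 - q i) = fun q => q i :=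
      funext fun q => if_pos h
    rw [e]
    exact continuous_apply i
  · have e : (fun q : ι → ℝ => if y i = true then q i else 1 - q i) = fun q => 1 - q i :=
      funext fun q => if_neg h
    rw [e]
    exact continuous_const.sub (continuous_apply i)

/-- **Uniform cubes suffice for product measures, dyadic case**: if every uniform weight is
Sahi-positive of order `n` then so is every product weight with dyadic biases `k_i/2^r`.
[cite: Kahn2022, p. 2 and footnote 1 (b); LiebSahi2021, Lemma 2.3] -/
theorem SahiPositive.coinWeight_dyadic_of_forall_uniform
    (hU : ∀ (ι : Type) [Fintype ι] [DecidableEq ι], SahiPositive (uniformWeight ι) n)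
    {m r : ℕ} {k : Fin m → ℕ} (hk : ∀ i, k i ≤ 2 ^ r) :
    SahiPositive (coinWeight fun i => (k i : ℝ) / 2 ^ r) n := by
  rw [← pushWeight_uniform_dyadicMap hk]
  exact (hU (Fin m × Fin r)).of_pushWeight (dyadicMap_mono m r k)

/-- **Uniform cubes suffice for product measures** (Lieb–Sahi's discretise-and-pass-to-the-limit,
Kahn's "`μ` is PA if it is a limit of measures obtained in this way"): if every uniform weight
`uniformWeight ι` is Sahi-positive of order `n`, then so is every product weight `coinWeight q`,
`q ∈ [0,1]^m` — approximate `q_i` by `⌊q_i 2^r⌋/2^r` and use the continuity of `E_n` in the weight.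
[cite: LiebSahi2021, Lemma 2.3; Kahn2022, p. 2] -/
theorem SahiPositive.coinWeight_of_forall_uniform
    (hU : ∀ (ι : Type) [Fintype ι] [DecidableEq ι], SahiPositive (uniformWeight ι) n)
    {m : ℕ} (q : Fin m → ℝ) (hq : ∀ i, 0 ≤ q i ∧ q i ≤ 1) : SahiPositive (coinWeight q) n := by
  intro f hf hmono
  have hcont : Continuous fun q' : Fin m → ℝ => sahiE (coinWeight q') n f :=
    (Literature.Probability.Percolation.BHK2006.continuous_sahiE n f).comp continuous_coinWeight
  have hlim : Tendsto (fun s : ℕ => fun i : Fin m => (⌊q i * (2 : ℝ) ^ s⌋₊ : ℝ) / (2 : ℝ) ^ s)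
      atTop (𝓝 q) :=
    tendsto_pi_nhds.2 fun i =>
      (tendsto_nat_floor_mul_div_atTop (hq i).1).comp (tendsto_pow_atTop_atTop_of_one_lt one_lt_two)
  refine ge_of_tendsto ((hcont.tendsto q).comp hlim) (Eventually.of_forall fun s => ?_)
  have hk : ∀ i : Fin m, ⌊q i * (2 : ℝ) ^ s⌋₊ ≤ 2 ^ s := by
    intro i
    have h1 : (⌊q i * (2 : ℝ) ^ s⌋₊ : ℝ) ≤ (2 : ℝ) ^ s :=
      (Nat.floor_le (mul_nonneg (hq i).1 (by positivity))).trans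
        (mul_le_of_le_one_left (by positivity) (hq i).2)
    exact_mod_cast h1
  exact SahiPositive.coinWeight_dyadic_of_forall_uniform hU hk f hf hmono

/-- **Sahi's `C_n` for the uniform cubes gives `C_n` for every FKG poset**: if for every finite
`ι : Type` the uniform weight on `ι → Bool` is Sahi-positive of order `n`, then every FKG probability
weight on every finite distributive lattice is Sahi-positive of order `n` (uniform ⇒ product by the
above; product ⇒ FKG by `UnderlyingIndependents.lean`, "FKG measures are FUI").
[cite: LiebSahi2021, §2 (Lebesgue setting) and Lemma 2.3; Kahn2022, pp. 2–3 and footnote 1] -/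
theorem SahiPositive.of_isFKGMeasure_of_forall_uniform
    (hU : ∀ (ι : Type) [Fintype ι] [DecidableEq ι], SahiPositive (uniformWeight ι) n)
    {α : Type*} [DistribLattice α] [Fintype α] {μ : α → ℝ} (hμ : IsFKGMeasure μ) :
    SahiPositive μ n :=
  SahiPositive.of_isFKGMeasure_of_forall_coinWeight
    (fun _ q hq => SahiPositive.coinWeight_of_forall_uniform hU q fun i => ⟨(hq i).1.le, (hq i).2.le⟩)
    hμ

/-- The cubes `Fin M → Bool` suffice (relabelling): uniform-cube positivity of order `n` for every
`Fin M` gives it for every finite index type. [cite: LiebSahi2021, §2 (before Lemma 2.2)] -/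
theorem SahiPositive.uniformWeight_of_forall_fin
    (hU : ∀ M : ℕ, SahiPositive (uniformWeight (Fin M)) n) (ι : Type*) [Fintype ι] [DecidableEq ι] :
    SahiPositive (uniformWeight ι) n := by
  rw [← pushWeight_uniformWeight_arrowCongr (Fintype.equivFin ι).symm]
  exact (hU _).of_pushWeight (arrowCongr_mono _)

end Limit

end Literature.Combinatorics.Sahi2008
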